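import Summits.BirchSwinnertonDyer.BirchSwinnertonDyer.Theorems.UniversalToricDescentTwinSplitIMCAtThreeGoodSSValueRoute
import HarnessLib

/-!
# Route `UniversalToricDescent`, child `TwinSplitIMCAtThreeGoodSS` (item stmt-BirchSwinnertonDyer-20695; bucket C =
# 603 of the 2 023 twin classes, good-SUPERSINGULAR twins at `3`): the UNIT TIER from REFEREED PRINT ALONE — at a
# unit pair crux #3 (i) ∧ (ii) hold VERBATIM with NO Howard frame, hence WITHOUT the CÇSS18 PRE claim

Seat `bsd-wall-utd-p2` g3 (D-0131 (3) MIDDLE tier; memo `HOME/bsd-wall/bsd-wall-utd-p2/SUPSET-AT3-v6.md`). Seat g2's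
value route on bucket C (`…GoodSSValueRoute`, p550002) reaches child 20695 at rank-one instances from {the OPEN
claim `CastellaCiperianiSkinnerSprung2018.…_OPEN` (Howard frame; unrefereed preprint), JSW 2017 Thm. 3.3.1, CGLS
2022 Thm. 5.1.3, `hIdx`}. This file removes the PRE claim on the UNIT sub-tier: when the control generator `F` is a
UNIT (`ord₃ F(0) = ord₃ #Ш + 2·((ord₃(4 − a₃) − 1 + ord₃ log_ω P) − ord₃[E′(K):ℤP]) + ord₃ ∏ c_w = 0`, i.e.
`3 ∤ #Ш(E′/K)[3^∞]`, `3 ∤ ∏_w c_w(E′/K)`, `3 ∤ [E′(K):ℤP]` and `ord₃ log_ω P = 1` — its least value at a good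
supersingular `3`, where `E′(ℚ₃) ⊗ ℤ₃ = Ê′(3ℤ₃)` because `#Ẽ′(𝔽₃) = 4 − a₃ ∈ {1, 4, 7}`), `Ch·R₀⟦T⟧ = ⊤` contains
EVERY frame, so a Howard frame comes for free; the CGLS frame has `‖L(0)‖ = ‖F(0)‖ = 1` (`3 ∤ c(Dt′)`), hence
generates `⊤`; integral cross-period rigidity (p536114) moves `⊤ = (L′)` to every frame. Result:

* `twinSplit_instance_of_goodSS_of_unitPair_of_thm331_of_thm513` — conjuncts (i) ∧ (ii) of `TwinSplitIMCAtThree`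
  VERBATIM at a good-supersingular UNIT pair, CONDITIONAL ONLY on the two REFEREED named facts `h331`
  (`JetchevSkinnerWan2017.thm331_anticyclotomicControl`) and `h513`
  (`CastellaGrossiLeeSkinner2022.thm513_exists_isBDPLFunction_valueAtOne_disc`). No PRE claim, no port, no `hIdx`.

PARTITION currency (bucket C, 603; census QU1 first pass: `|C_unit| ≥ 266` classes with a unit pair of record =
255 `r′ = 1` + 11 `r′ = 0`, GZ index identity; Manin `c = 1` for all 10 586 bucket-C twins, QC1): child 20695 at the
C_unit rank-one instances is now refereed-print-only in the route's OWN `R₀`-currency; the non-unit rank-one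
instances keep {PRE claim, JSW17, CGLS22, `hIdx`} (p550002); `r_an(E′/K) ≥ 3` instances keep the three-frames line.
Degenerate tier (both sides `⊤`). Beyond-print BSD theorem: NO. `--supports stmt-BirchSwinnertonDyer-20695`.

References: [JetchevSkinnerWan2017] Thm. 3.3.1, (3.5.d), §7.4.1; [CastellaGrossiLeeSkinner2022] Thm. 5.1.3;
[Castella2018] Thm. 3.1 (frame predicate); [GrossLMS1991] Thm. 1.3 (why the unit clauses are the GZ–BSD corner).
-/

noncomputable section

open scoped Classical Topology

set_option linter.dupNamespace false
set_option autoImplicit false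

namespace Summit.BirchSwinnertonDyer.BirchSwinnertonDyer.Theorems.UniversalToricDescentTwinSplit

open Filter PowerSeries WeierstrassCurve NumberField IsDedekindDomain Field
  Literature.NumberTheory.EllipticCurves
  Literature.NumberTheory.EllipticCurves.ModularForms
  Literature.NumberTheory.EllipticCurves.Rank1Residual
  Literature.NumberTheory.EllipticCurves.JetchevSkinnerWan2017
  Literature.NumberTheory.EllipticCurves.CastellaGrossiLeeSkinner2022
  Literature.NumberTheory.GaloisRepresentations
  Summit.BirchSwinnertonDyer.Rank1Residual
  Summit.BirchSwinnertonDyer.Rank1Residual.X11b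
  Summit.BirchSwinnertonDyer.Rank1Residual.X11b.Halves
  Summit.BirchSwinnertonDyer.Rank1Residual.X11b.CongruenceLimit
  Summit.BirchSwinnertonDyer.BirchSwinnertonDyer.Theorems.SchneiderFree

section Three

variable (W' : WeierstrassCurve ℚ) [W'.IsElliptic] [W'.IsGloballyMinimal] (N' : ℕ) [NeZero N']
  (K : Type) [Field K] [NumberField K] (Dt' : ModularParametrizationData W' N')
  (κ : ZpExtension K 3) (γ : absoluteGaloisGroup K)
  (𝔭 𝔭' : HeightOneSpectrum (𝓞 K)) (ι' : PadicAlgCl 3 ≃+* ℂ)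

/-- **Crux #3 VERBATIM at a good-supersingular twin over a UNIT pair, from REFEREED print alone — no Howard frame,
no PRE claim.** `W′` globally minimal, GOOD SUPERSINGULAR at `3` (`3 ∣ a₃`), `ρ̄_{W′,3}` onto over `ℚ`, conductor
`N′`; `Dt′` a parametrisation datum with `3 ∤ c(Dt′)`; `K` imaginary quadratic Heegner for `N′` with `d_K` odd; `κ`
anticyclotomic with topological generator `γ`; `𝔭 ∋ 3` of degree one, `𝔭′ ∋ 3` (the STRICT prime); `ι′` inducing
`𝔭`; `H` a Heegner datum and `P ∈ E′(K)` over its Heegner point (along `w.embedding`), of infinite order;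
`rank_ℤ E′(K) = 1`, `Ш(E′/K)[3^∞]` finite; UNIT clauses `3 ∤ #Ш(E′/K)[3^∞]`, `3 ∤ ∏_w c_w(E′/K)`,
`3 ∤ [E′(K):ℤP]`, `‖log_ω P‖ = 3⁻¹` at `embAt K 3 𝔭`. Then conjuncts (i) ∧ (ii) of `TwinSplitIMCAtThree` hold at
`(W′, N′, K, Dt′, κ, γ, 𝔭, 𝔭′, ι′)`: JSW control at `𝔭′` gives `Ch = (F)` with `ord₃ F(0) = 0 + 2·((0 − 1 + 1) − 0)
+ 0 = 0` (`ord₃(1 − a₃ + 3) = 0`; `ord₃ log` transported from `𝔭` by `LogSymmetry.padicLogOrd_eq_of_finrank_eq_two`),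
so `Ch·R₀⟦T⟧ = ⊤`; the CGLS frame `L` has `‖L(0)‖ = ‖F(0)‖ = 1` (`norm_constantCoeff_eq_of_valueShape`), and
`twinSplit_instance_of_howardFrame_of_valueFrame` (p547868) applies with `L` as BOTH the Howard frame (`⊤ ∋ L`)
and the value frame. CONDITIONAL ONLY on `h331` and `h513` (both refereed).
[cite: JetchevSkinnerWan2017, Thm. 3.3.1 with §3.5 (3.5.d), §7.4.1 (arXiv:1512.06894 pp. 11, 16, 30)]
[cite: CastellaGrossiLeeSkinner2022, Thm. 5.1.3 (Invent. Math. 227)] -/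
theorem twinSplit_instance_of_goodSS_of_unitPair_of_thm331_of_thm513
    (h331 : thm331_anticyclotomicControl) (h513 : thm513_exists_isBDPLFunction_valueAtOne_disc)
    (hss : GoodSS W' 3) (hsurj : W'.HasSurjectiveModNGaloisRep 3) (hN' : W'.conductorNorm ℤ = N') (hcM : ¬ (3 : ℤ) ∣ Dt'.c)
    (hK : IsImaginaryQuadratic K) (hH : SatisfiesHeegnerHypothesis N' K) (hodd : Odd (NumberField.discr K))
    (hκ : κ.IsAnticyclotomic) [hγ : Fact (κ.IsTopGenerator γ)]
    (h𝔭 : ((3 : ℕ) : 𝓞 K) ∈ 𝔭.asIdeal) (he : 𝔭.asIdeal.ramificationIdx (𝓞 ℚ) = 1)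
    (hf : 𝔭.asIdeal.inertiaDeg (𝓞 ℚ) = 1) (h𝔭' : ((3 : ℕ) : 𝓞 K) ∈ 𝔭'.asIdeal) (hι' : BranchInducesPrime 3 ι' 𝔭)
    (H : HeegnerDatum N' (NumberField.discr K)) (w : InfinitePlace K) (P : (W'.baseChange K).toAffine.Point)
    (hPH : WeierstrassCurve.Affine.Point.map w.embedding.toRatAlgHom P = heegnerPointComplex Dt' H) (hP0 : ¬ IsOfFinAddOrder P)
    (hrk : (W'.baseChange K).mordellWeilRank = 1) (hfin : Finite (AddCommGroup.primaryComponent (W'.baseChange K).sha 3))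
    (hSha : ¬ 3 ∣ Nat.card (AddCommGroup.primaryComponent (W'.baseChange K).sha 3))
    (hTam : ¬ 3 ∣ (W'.baseChange K).tamagawaProduct) (hInd : ¬ 3 ∣ (AddSubgroup.zmultiples P).index)
    (hlog : ‖Castella2018.padicLogOmega W' 3 (embAt K 3 𝔭 h𝔭 he hf) P‖ = (3 : ℝ)⁻¹) :
    (∃ (ΩK : ℂ) (Ωp : ℂ_[3]) (L' : UnrSeries 3), ΩK ≠ 0 ∧ Ωp ≠ 0 ∧
        IsBDPLFunction ι' 𝔭 κ γ Dt'.f ΩK Ωp L') ∧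
      (∀ (ΩK : ℂ) (Ωp : ℂ_[3]) (L' : UnrSeries 3), ΩK ≠ 0 → Ωp ≠ 0 →
        IsBDPLFunction ι' 𝔭 κ γ Dt'.f ΩK Ωp L' →
        (AcSelmer.XAc.charIdeal (W'.baseChange K) 3 κ 𝔭' ∅ γ).map (PowerSeries.map (toUnr 3)) =
          Ideal.span {L'}) := by
  have h2 : Module.finrank ℚ K = 2 := hK.1
  have hspl : ((Ideal.span {((3 : ℕ) : ℤ)}).primesOver (𝓞 K)).ncard = 2 :=
    ncard_primesOver_eq_two_of_degreeOne h2 h𝔭 he hf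
  have hirrK : (W'.baseChange K).HasIrreducibleModPGaloisRep 3 := irrK_of_surj W' 3 hsurj K h2
  have hd3 : NumberField.discr K ≠ -3 := discr_ne_neg_three_of_degreeOne hK h𝔭 he hf
  obtain ⟨he', hf'⟩ := degreeOne_of_splitsIn (p := 3) h2 hspl h𝔭'
  have h3N : ¬ 3 ∣ N' := by
    rw [← hN']
    intro h
    exact ((W'.dvd_conductorNorm_iff_not_hasGoodReductionAtPrime 3).mp h) hss.1
  have hH3 : SatisfiesHeegnerHypothesis 3 K := satisfiesHeegnerHypothesis_three_of_ncard hspl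
  have hHN : SatisfiesHeegnerHypothesis (W'.conductorNorm ℤ) K := by rw [hN']; exact hH
  set e := embAt K 3 𝔭 h𝔭 he hf with hedef
  set e' := embAt K 3 𝔭' h𝔭' he' hf' with he'def
  -- CONTROL at the strict prime `𝔭′` (JSW 3.3.1, good)
  obtain ⟨-, f₀, hf₀, hf₀0, hval⟩ := h331 W' 3 le_rfl hss.1 K hK hH3 hHN hirrK e' 𝔭'
    (mem_asIdeal_iff_norm_embAt_lt_one 𝔭' h𝔭' he' hf') κ hκ γ hrk hfin P hP0
  -- VALUE at the frame's prime `𝔭` (CGLS 5.1.3)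
  obtain ⟨ΩK, Ωp, L, hΩK, hL, u, hLval⟩ := h513 ι' W' K 𝔭 κ γ Dt' H w e P (by decide) h3N hK hspl
    h𝔭 hι' hH hodd hd3 hκ hγ.out hPH (mem_asIdeal_iff_norm_embAt_lt_one 𝔭 h𝔭 he hf)
  have hΩp : ((Ωp : unrIntegers 3) : ℂ_[3]) ≠ 0 := by
    intro h0
    have h1 := norm_coe_units_unrIntegers 3 Ωp
    rw [h0, norm_zero] at h1
    exact zero_ne_one h1
  -- the logarithm: non-zero, `ord₃ = 1` at `e`, the same at `e'`
  have hx0 : Castella2018.padicLogOmega W' 3 e P ≠ 0 :=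
    Rank1Residual.O5.HeegnerLogTransport.padicLogOmega_ne_zero W' 3 e hP0
  have hxval : (Castella2018.padicLogOmega W' 3 e P).valuation =
      Literature.NumberTheory.EllipticCurves.padicLogOrd W' 3 e P :=
    Castella2018.valuation_padicLogOmega hx0
  have hxval1 : (Castella2018.padicLogOmega W' 3 e P).valuation = 1 := by
    have hn := Padic.norm_eq_zpow_neg_valuation hx0
    rw [hlog] at hn
    have := zpow_right_injective₀ (by norm_num : (0 : ℝ) < 3) (by norm_num : (3 : ℝ) ≠ 1)
      (show ((3 : ℕ) : ℝ) ^ (-(1 : ℤ)) = ((3 : ℕ) : ℝ) ^ (-(Castella2018.padicLogOmega W' 3 e P).valuation) by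
        rw [← hn]; norm_num)
    linarith
  have htrans : Literature.NumberTheory.EllipticCurves.padicLogOrd W' 3 e' P =
      Literature.NumberTheory.EllipticCurves.padicLogOrd W' 3 e P := by
    rw [← padicLogOrd_eq_literature, ← padicLogOrd_eq_literature]
    exact LogSymmetry.padicLogOrd_eq_of_finrank_eq_two W' 3 (by decide) h2 e e' hrk P hP0
  -- `ord₃ f₀(0) = 0`: the generator is a unit, `Ch·R₀⟦T⟧ = ⊤`
  have hc0 : padicValInt 3 Dt'.c = 0 := padicValInt.eq_zero_of_not_dvd hcM
  have hval0 : ((PowerSeries.constantCoeff f₀).valuation : ℤ) = 0 := by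
    rw [hval, htrans, ← hxval, hxval1, padicValInt_one_sub_add_three_of_dvd hss.2,
      padicValNat.eq_zero_of_not_dvd hSha, padicValNat.eq_zero_of_not_dvd hTam, padicValNat.eq_zero_of_not_dvd hInd]
    simp
  have hf₀u : IsUnit f₀ := by
    rw [PowerSeries.isUnit_iff_constantCoeff, PadicInt.isUnit_iff, PadicInt.norm_eq_zpow_neg_valuation hf₀0]
    have : ((PowerSeries.constantCoeff f₀).valuation : ℤ) = 0 := hval0
    simp [this]
  have hCh : (AcSelmer.XAc.charIdeal (W'.baseChange K) 3 κ 𝔭' ∅ γ).map (PowerSeries.map (toUnr 3)) =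
      Ideal.span {PowerSeries.map (toUnr 3) f₀} := by
    rw [xac_charIdeal_eq_literature, hf₀, map_span_singleton_powerSeries]
  have hFu : IsUnit (PowerSeries.map (toUnr 3) f₀) := hf₀u.map _
  have hF0 : PowerSeries.constantCoeff (PowerSeries.map (toUnr 3) f₀) ≠ 0 :=
    (PowerSeries.isUnit_iff_constantCoeff.mp hFu).ne_zero
  have htop : (AcSelmer.XAc.charIdeal (W'.baseChange K) 3 κ 𝔭' ∅ γ).map (PowerSeries.map (toUnr 3)) = ⊤ := by
    rw [hCh, Ideal.span_singleton_eq_top]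
    exact hFu
  -- the CGLS frame has `‖L(0)‖ = ‖F(0)‖` (`= 1`): value shape + `ord₃ f₀(0) = 2·(0 − 1 + 1 − 0)`
  have hLn : ‖((PowerSeries.constantCoeff L : unrIntegers 3) : ℂ_[3])‖ =
      ‖((PowerSeries.constantCoeff (PowerSeries.map (toUnr 3) f₀) : unrIntegers 3) : ℂ_[3])‖ := by
    have hcZ : Dt'.c ≠ 0 := Dt'.maninConstant_ne_zero_holds
    refine norm_constantCoeff_eq_of_valueShape hf₀0 u hcZ (one_sub_add_three_ne_zero_of_dvd hss.2) hx0 hLval ?_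
    rw [hval0, padicValInt_one_sub_add_three_of_dvd hss.2, hxval1, hc0]
    simp
  have hmem : L ∈ (AcSelmer.XAc.charIdeal (W'.baseChange K) 3 κ 𝔭' ∅ γ).map (PowerSeries.map (toUnr 3)) := by
    rw [htop]; exact Submodule.mem_top
  exact twinSplit_instance_of_howardFrame_of_valueFrame W' N' K Dt' κ γ 𝔭 𝔭' ι' hK hκ hCh hF0
    ⟨ΩK, ((Ωp : unrIntegers 3) : ℂ_[3]), L, hΩK, hΩp, hL, hmem⟩
    ⟨ΩK, ((Ωp : unrIntegers 3) : ℂ_[3]), L, hΩK, hΩp, hL, hLn⟩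

end Three

end Summit.BirchSwinnertonDyer.BirchSwinnertonDyer.Theorems.UniversalToricDescentTwinSplit

end
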